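import Mathlib

/-!
# `Balaban1983to89.B15` — T. Bałaban, *Large field renormalization. I. The basic step of the 𝐑 operation*,
Commun. Math. Phys. **122**, 175–202 (1989), doi:10.1007/bf01257412.  (Cell numbering: B15 = "[IV]" of
[Balaban1989LargeFieldII]; its refs [I] = [Balaban1987RG1] (B12), [II] = [Balaban1988RG2Cluster] (B13), [III] =
[Balaban1988Convergent] (B14); numeric [n] = B12's list: p. 175 "(this refers to References in the paper [I])".)
PDF held: `paper:balaban1989-cmp122-large-field-i` (journal page = PDF page + 174).

CITATION HEADER (lean-in-tree rule 2026-08-18).  This module is a TYPED SKELETON (statement level) of the published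
paper [Balaban1989LargeFieldI] (cell paper B15).  WHAT IS REPRODUCED: the general structure of the 𝐑 operation
(0.2)–(0.6) (p. 176) as definitions/Props over an abstract integration datum; the paper's ONE numbered result,
Proposition 1 (p. 194: existence/uniqueness of the critical orbit V_Λ, the bound (1.78), analytic extension),
VERBATIM, over an abstract carrier; and the shape of the deferred bound (1.80) (p. 195).  NOTHING of the series is
asserted; `Prop1Printed` is consumed downstream only as a hypothesis.  Adjudication notes carried in the docstrings:
Proposition 1's proof is given only in [Balaban1989LargeFieldII] pp. 358–359 ("for ε_k instead of a general ε, but the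
generalization is obvious" — cell GAPS.md G-r2.4/G-r2.4b); (1.80) is stated with proof deferred ("we will need a
stronger statement in the future").  Why an abstract integration datum and not the shared `Setup` vocabulary
(`…Balaban1983to89.Setup`): `Setup.LargeFieldDecomp` is the decomposition (0.2) `ρ(V) = Σ_Z ρ(Z, V)` and
`Setup.PreservesIntegral` the normalisation (0.4) over the CONCRETE product Haar measure of one lattice, and `Setup`
deliberately leaves the operation itself reader-owned ("enters only through such properties"); the defining formula
(0.3) needs RESTRICTED integrals `∫dV⌈_{Z′}` over the bond variables of a sub-region (conditional product-Haar
integration), which `Setup` does not model — so (0.3)/(0.5)/(0.6) are typed here over an abstract `RData` whose fields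
name `∫dV`, `∫dV⌈_{Z′}`, `Z ↦ Z′, Z″`; `Normalization04` is the abstract counterpart of `Setup.PreservesIntegral` for
that datum (nothing of `Setup` is restated).  Staged byte-identically in the cell package
`run/shared/lean/pub/pub-balaban/lean/BalabanYm4/Literature/…/B15.lean` (legacy copy `BalabanYm4/B15.lean` there,
namespace `BalabanYm4.B15`, same declarations).  Unit `b2b-balaban-r2` (reader group B+C); companion prose
`HOME/b2b-balaban-r2/B15.md`.

Scope / d-dependence sentences (p. 175 [1]; REVISION v2 — every passage below re-read VERBATIM on the page render
`HOME/b2b-balaban-ref1/pages/1989-cmp122-large-field-I/1989-cmp122-large-field-I-p001-x2.png`; v1 of this header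
carried three passages in quotation marks that are NOT printed in the paper — cell GAPS.md G-pv13-2 — and they are
withdrawn here together with the inference built on them; no declaration of the module is affected).  Abstract,
complete: *"We construct the renormalization operation of the expressions connected with the large field regions.
This operation, denoted by 𝐑, removes the main obstacle to prove the ultraviolet stability of four-dimensional gauge
field theories. The proof will be completed in the second part of this paper."*  Introduction: *"Consider a large
plaquette variable in the first step. The restrictions on these variables are the same as in [16] (this refers to
References in the paper [I]), so we have |U(∂p) − 1| ≧ g₀p₀(g₀) for a plaquette p ∈ T₁, where p₀(g₀) =
A₀(log g₀⁻²)^{p₀} with a positive integer p₀. The term in the Wilson action, corresponding to the plaquette p, gives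
the estimate"* (0.1) *"exp[−(1/g₀²)[1 − Re tr U(∂p)]] ≦ exp(−p₀(g₀)) = g₀^{A₀(log g₀⁻²)^{p₀−1}}."* — (0.1) of THIS
paper is a one-plaquette estimate, not an integral.  The d-dichotomy, verbatim: *"For d < 4 we have g₀ =
gε^{1/2(4−d)}, and the bound above can be estimated by an arbitrarily large power of ε. This is enough to control
expressions arising in the large field regions surrounding the plaquette p for all steps of the procedure, i.e., until
we reach the unit lattice. For d = 4 the bare coupling constant behaves asymptotically as (a + b log ε⁻¹)^{−1/2}, for
ε → 0, with some positive constants a, b, hence the bound does not give any positive power of ε. It is still small for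
ε small, and it controls a large number of steps, but this number is a small fraction of the total number of steps.
Thus, for some large field regions there is a difficulty in continuing the procedure of [16], the small factor arising
from large fields in this region does not control further steps. In such situations we have to change the procedure
in order to improve the small factor, i.e., we have to be able to renormalize the expression corresponding to the
large field region."* ([16] = the d = 3 paper [Balaban1985UV3] of [I]'s list.)  Reading (the cell's, not a
quotation): the 𝐑 operation of this paper and of [Balaban1989LargeFieldII] is the d = 4-specific part of the series;
the printed exponent "ε^{1/2(4−d)}" is read as `g₀ = g ε^{(4−d)/2}` (cell DIVERGENCE.md D-r2.4; consistent with
[Balaban1985UV3] (1) g₀² = g²ε^{4−d}).  The paper's genuine forward references are p. 195 (1.80) *"we will need a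
stronger statement in the future"* (G-r2.4b) and p. 202 [28] *"All these operations will be described in the next
paper."* (= [Balaban1989LargeFieldII]).
-/

namespace Literature.MathematicalPhysics.QuantumFieldTheory.Balaban1983to89.B15

/-- Abstract integration datum for (0.2)–(0.6) (p. 176 [2]): gauge-field variables `V : Vsp`, an integral `Int`
over them ("∫dV"), large-field regions `Z : Reg` (a finite index type) with the maps `Z ↦ Z′` (`Zp`) and `Z ↦ Z″`
(`Zpp`) of the decomposition "Z = Z′ ∪ Z″", restricted integrals `IntOver Z' f` ("∫dV⌈_{Z′}"), and the pieces
`ρ Z V` of the density, `ρ(V) = Σ_Z ρ(Z, V)` (0.2). [cite: Balaban1989LargeFieldI, (0.2) p.176] -/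
structure RData where
  Vsp : Type
  Reg : Type
  instF : Fintype Reg
  Int : (Vsp → ℝ) → ℝ
  IntOver : Reg → (Vsp → ℝ) → ℝ
  Zp : Reg → Reg
  Zpp : Reg → Reg
  ρ : Reg → Vsp → ℝ

attribute [instance] RData.instF

/-- **(0.3)** p. 176 [2], verbatim: *"(𝐑ρ)(V) = Σ_Z ρ(Z″, V) ∫dV⌈_{Z′} ρ(Z, V) / ∫dV⌈_{Z′} ρ(Z″, V)."*  With the
printed proviso: *"We will prove that the densities are positive, and the integration domains in the integrals
above are nonempty, hence the denominators are positive, and the operation 𝐑 is well defined."* (here: real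
division, junk value 0 at a vanishing denominator — the proviso is what downstream hypotheses must supply). [cite: Balaban1989LargeFieldI, (0.3) p.176] -/
noncomputable def Rop (D : RData) : D.Vsp → ℝ :=
  fun V => ∑ Z : D.Reg, D.ρ (D.Zpp Z) V * (D.IntOver (D.Zp Z) (D.ρ Z) / D.IntOver (D.Zp Z) (D.ρ (D.Zpp Z)))

/-- **(0.4)** p. 176 [2], verbatim: *"It satisfies the basic normalization property ∫dV(𝐑ρ)(V) = ∫dVρ(V)."* — the
defining requirement on 𝐑 ("integrals of the densities are unchanged"); a leaf whose verification depends on the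
meaning of `∫dV⌈_{Z′}` (Sect. 1 of the paper).  Abstract counterpart of `…Balaban1983to89.Setup`'s
`PreservesIntegral` (same property over the concrete product Haar measure). [cite: Balaban1989LargeFieldI, (0.4) p.176] -/
def Normalization04 (D : RData) : Prop :=
  D.Int (Rop D) = D.Int (fun V => ∑ Z : D.Reg, D.ρ Z V)

/-- **(0.5)–(0.6)** p. 176 [2], verbatim: *"Σ_{Z′⊂Z″ᶜ} ∫dV⌈_{Z′}ρ(Z′∪Z″, V) / ∫dV⌈_{Z′}ρ(Z″, V) = exp Σ_X 𝐑(X, V),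
(0.5) where the last sum is over X such, that X ∩ Z″ᶜ ≠ ∅"*, *"(𝐑ρ)(V) = Σ_{Z″} ρ(Z″, V) exp Σ_X 𝐑(X, V). (0.6)"* —
the localized-exponentiated form whose terms 𝐑^{(k)}(X) then enter (2.18) of [Balaban1988Convergent] with the bounds
(2.32) there.  Typed as the shape of (0.6): an index type of regions Z″ with pieces `ρpp` and exponent sums `Rsum`. [cite: Balaban1989LargeFieldI, (0.5)–(0.6) p.176] -/
def ExpForm06 (D : RData) (Zpp : Type) [Fintype Zpp] (ρpp : Zpp → D.Vsp → ℝ) (Rsum : Zpp → D.Vsp → ℝ) :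
    Prop :=
  ∀ V, Rop D V = ∑ z : Zpp, ρpp z V * Real.exp (Rsum z V)

/-- Abstract carrier for Proposition 1 (pp. 193–194 [19–20]): instances `i` (the step k, the large-field region Z,
the domain Λ, the geometry incl. the cube size `M i`), boundary data `W = V_k⌈_{Z∩Λᶜ}` (`Bdry i`), gauge orbits of
configurations on Λ (`Orbit i`), the regularity predicate `Regular i ε W` = "|∂V_k − 1| < ε on Z ∩ Λᶜ", critical /
minimal orbits of the function (1.77) `V_k⌈_Λ ↦ A(U_{k,Z}(V_k))` (`IsCritical`, `IsMinimum`), the deviation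
`dev i O` = `sup_{p′∈Λ} |V_Λ(∂p′) − 1|`, and the analytic-extension clause left as one predicate `AnalyticExt i ε W`. [cite: Balaban1989LargeFieldI, (1.77) pp.193–194] -/
structure LFVar where
  Inst : Type
  M : Inst → ℝ
  Bdry : Inst → Type
  Orbit : Inst → Type
  Regular : (i : Inst) → ℝ → Bdry i → Prop
  IsCritical : (i : Inst) → Bdry i → Orbit i → Prop
  IsMinimum : (i : Inst) → Bdry i → Orbit i → Prop
  dev : (i : Inst) → Orbit i → ℝ
  AnalyticExt : (i : Inst) → ℝ → Bdry i → Prop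

/-- **Proposition 1**, verbatim (p. 194 [20]; introduced by "We look for a minimal orbit. We will prove later the
following theorem."): *"For a configuration V_k⌈_{Z∩Λᶜ}, satisfying the regularity condition |∂V_k − 1| < ε on the
domain Z ∩ Λᶜ, for ε > 0 sufficiently small, there exists exactly one critical orbit of the function (1.77)
[= V_k⌈_Λ → A(U_{k,Z}(V_k))]. An element of the orbit is a minimum of the function, and is denoted by
V_Λ = V_Λ(V_k⌈_{Z∩Λᶜ}). It satisfies the regularity condition |V_Λ(∂p′) − 1| < B₅M⁵ε for p′ ∈ Λ. (1.78)  The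
orbit-valued function V_Λ(V_k⌈_{Z∩Λᶜ}) has an analytic extension for Gᶜ-valued configurations 𝕍_k = V′_kV_k =
exp iB′V_k satisfying the same regularity condition as V_k, with B′ ∈ gᶜ and small, e.g., |B′| < ε."*  p. 195 [21]:
*"The constant B₅ is determined by the geometry of the problem, more precisely by the condition (i). The power M⁵ is
not the optimal one, in fact we can take just M, but we will not prove it."*  PROOF: only in [Balaban1989LargeFieldII]
pp. 358–359 ("Now we prove Proposition 1 [IV]. For simplicity of the argument let us use the fact that V_k belongs to
the domain determined by the characteristic functions χ_kχ_{k,Λ} …"; "It is proved for ε_k instead of a general ε, but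
the generalization is obvious.") — cell GAPS.md G-r2.4/G-r2.4b.  Quantifier order typed: B₅ FIRST (instance-independent,
"determined by … the condition (i)"); the smallness threshold for ε ("sufficiently small", dependence unprinted) is
allowed to depend on the instance — the weakest reading. [cite: Balaban1989LargeFieldI, Prop. 1 (1.78) p.194] -/
def Prop1Printed (P : LFVar) : Prop :=
  ∃ B₅ : ℝ, 0 < B₅ ∧ ∀ i : P.Inst, ∃ e0 : ℝ, 0 < e0 ∧ ∀ ε : ℝ, 0 < ε → ε ≤ e0 →
    ∀ W : P.Bdry i, P.Regular i ε W →
      ∃ O : P.Orbit i, P.IsCritical i W O ∧ (∀ O' : P.Orbit i, P.IsCritical i W O' → O' = O) ∧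
        P.IsMinimum i W O ∧ P.dev i O < B₅ * (P.M i) ^ 5 * ε ∧ P.AnalyticExt i ε W

/-- **(1.79)–(1.80)** p. 195 [21], verbatim: *"U₀ = U_{k,Z}(V_Λ). (1.79) … |U₀(∂p) − 1| < 2ε_kη² + O(1)B₃B₅M⁵
exp(−δ dist(p, Λ))ε_kη² (1.80) for p ∈ Ω_k. We will discuss it together with the proof of Proposition 1, because then
it will be immediate, but it follows also quite generally from the definition (1.79) and the bound (1.78). … We do
not show the above statement now, because we will need a stronger statement in the future."*  Used in
[Balaban1989LargeFieldII] p. 361 ("Using the estimate (1.80) [IV] and Theorem 1 [15]").  Typed as the shape of the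
bound for one plaquette, with the O(1) as an explicit constant `C`. [cite: Balaban1989LargeFieldI, (1.79)–(1.80) p.195] -/
def Ineq180 (dev εk η B₃ B₅ M δ distpΛ C : ℝ) : Prop :=
  dev < 2 * εk * η ^ 2 + C * B₃ * B₅ * M ^ 5 * Real.exp (-δ * distpΛ) * εk * η ^ 2

end Literature.MathematicalPhysics.QuantumFieldTheory.Balaban1983to89.B15
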